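import Mathlib
import HarnessLib
import Summits.AtomisticToContinuum.Crystallization.Theorems.FrustratedLawDichotomyAperiodicFrustratedLawGapErgodicCampbellSpace

/-!
# Ergodic reduction for the crux `AperiodicFrustratedLawGap` — the re-rooting operator on `L²`

Route `FrustratedLawDichotomy`, crux `AperiodicFrustratedLawGap` (item `stmt-AtomisticToContinuum-27623`),
registered stub `stub_ergodicReduction` (skeleton `dd3251ad731e`); eighth brick of step D5 (`hErg`; evidence
`D5-PLAN.md`, S1).  The Hilbert-space realisation of the lazy re-rooting operator: with
`π = (ν ⊗ₘ κ₀).withDensity W` (`…ErgodicCampbellWeight`), `E f = f ∘ p₁ : L²(ν) → L²(π)` (isometry,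
`measurePreserving_fst_campbell`) and `U h = h ∘ Θ : L²(π) → L²(π)` (isometry, `measurePreserving_reroot_campbell`),
the operator `P = E† ∘ U ∘ E` is a contraction of `L²(ν)` whose matrix elements are the weighted Campbell
integrals `⟪g, P f⟫ = ∫ g(p.1) f((Θ p).1) dπ(p)` — by `…ErgodicMatrixElement` these are the matrix elements of
the pointwise lazy re-rooting operator.  Stated as an existence result (no definition is introduced):

* `exists_rerootOperator` — `∃ P : L²(ν) →L[ℝ] L²(ν)`, `‖P‖ ≤ 1`, with the matrix-element formula for all
  `f, g ∈ L²(ν)` (given as functions with `MemLp` witnesses).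

The mean ergodic theorem (`ContinuousLinearMap.tendsto_birkhoffAverage_orthogonalProjection`) applies to `P`.
`[folklore]`.
-/

noncomputable section

namespace Summit.AtomisticToContinuum.Crystallization.Theorems.FrustratedLawDichotomyErgodicReduction

open MeasureTheory Set Filter ProbabilityTheory
open scoped ENNReal Classical InnerProductSpace
open Literature.Probability.Process (LocalConfig)
open Literature.Probability.Process.LocalConfig (RootedHardCoreConfig toMeasure_def measurable_toMeasure)
open Summit.AtomisticToContinuum.Crystallization.Theorems.BenjaminiSchrammLimit (isSFiniteKernel_toMeasure
  measurable_reroot)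

variable {δ : ℝ}

/-- **The re-rooting operator on `L²(ν)`** (`δ > 0`).  For a probability law `ν` on rooted `δ`-hard-core
configurations of `ℝ³` with Campbell measure invariant under the re-rooting involution `Θ`, and a measurable
even weight `w` of mass `≤ 1` on every configuration, there is a bounded operator `P` on `L²(ν)` with
`‖P‖ ≤ 1` and matrix elements `⟪g, P f⟫ = ∫ g(p.1) f((Θ p).1) dπ(p)`, `π = (ν ⊗ₘ κ₀).withDensity W`,
`W(S,y) = w(y) + (1 − Σ_{z∈S} w(z)) 1[y = 0]`: namely `P = E† ∘ U ∘ E` with `E f = f ∘ p₁`, `U h = h ∘ Θ`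
(`MeasureTheory.Lp.compMeasurePreservingₗᵢ`). [folklore] -/
theorem exists_rerootOperator [Fact (0 < δ)]
    {ν : Measure (RootedHardCoreConfig (EuclideanSpace ℝ (Fin 3)) δ)} [IsProbabilityMeasure ν]
    (hinv : haveI := isSFiniteKernel_toMeasure (E := EuclideanSpace ℝ (Fin 3)) (δ := δ)
      (ν ⊗ₘ (⟨fun S : RootedHardCoreConfig (EuclideanSpace ℝ (Fin 3)) δ =>
        (S.1 : LocalConfig (EuclideanSpace ℝ (Fin 3))).toMeasure,
        measurable_toMeasure (Fact.out : 0 < δ)⟩ :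
        Kernel (RootedHardCoreConfig (EuclideanSpace ℝ (Fin 3)) δ) (EuclideanSpace ℝ (Fin 3)))).map
      (fun p : RootedHardCoreConfig (EuclideanSpace ℝ (Fin 3)) δ × EuclideanSpace ℝ (Fin 3) =>
        ((if h : p.2 ∈ ((p.1.1 : LocalConfig (EuclideanSpace ℝ (Fin 3))) : Set (EuclideanSpace ℝ (Fin 3)))
          then p.1.reroot p.2 h else p.1 : RootedHardCoreConfig (EuclideanSpace ℝ (Fin 3)) δ), -p.2)) =
      ν ⊗ₘ (⟨fun S : RootedHardCoreConfig (EuclideanSpace ℝ (Fin 3)) δ =>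
        (S.1 : LocalConfig (EuclideanSpace ℝ (Fin 3))).toMeasure,
        measurable_toMeasure (Fact.out : 0 < δ)⟩ :
        Kernel (RootedHardCoreConfig (EuclideanSpace ℝ (Fin 3)) δ) (EuclideanSpace ℝ (Fin 3))))
    {w : EuclideanSpace ℝ (Fin 3) → ℝ≥0∞} (hw : Measurable w) (hws : ∀ y, w (-y) = w y)
    (hw1 : ∀ S : RootedHardCoreConfig (EuclideanSpace ℝ (Fin 3)) δ,
      ∫⁻ y, w y ∂((S.1 : LocalConfig (EuclideanSpace ℝ (Fin 3))).toMeasure) ≤ 1) :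
    ∃ P : Lp ℝ 2 ν →L[ℝ] Lp ℝ 2 ν, ‖P‖ ≤ 1 ∧
      ∀ (f g : RootedHardCoreConfig (EuclideanSpace ℝ (Fin 3)) δ → ℝ) (hf : MemLp f 2 ν) (hg : MemLp g 2 ν),
        ⟪hg.toLp g, P (hf.toLp f)⟫_ℝ =
          ∫ q, g q.1 * f ((fun p : RootedHardCoreConfig (EuclideanSpace ℝ (Fin 3)) δ × EuclideanSpace ℝ (Fin 3) =>
            ((if h : p.2 ∈ ((p.1.1 : LocalConfig (EuclideanSpace ℝ (Fin 3))) : Set (EuclideanSpace ℝ (Fin 3)))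
              then p.1.reroot p.2 h else p.1 : RootedHardCoreConfig (EuclideanSpace ℝ (Fin 3)) δ), -p.2)) q).1
          ∂(haveI := isSFiniteKernel_toMeasure (E := EuclideanSpace ℝ (Fin 3)) (δ := δ)
            ((ν ⊗ₘ (⟨fun S : RootedHardCoreConfig (EuclideanSpace ℝ (Fin 3)) δ =>
                (S.1 : LocalConfig (EuclideanSpace ℝ (Fin 3))).toMeasure,
                measurable_toMeasure (Fact.out : 0 < δ)⟩ :
                Kernel (RootedHardCoreConfig (EuclideanSpace ℝ (Fin 3)) δ) (EuclideanSpace ℝ (Fin 3)))).withDensity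
              (fun p : RootedHardCoreConfig (EuclideanSpace ℝ (Fin 3)) δ × EuclideanSpace ℝ (Fin 3) =>
                w p.2 + (1 - ∫⁻ z, w z ∂((p.1.1 : LocalConfig (EuclideanSpace ℝ (Fin 3))).toMeasure)) *
                  ({(0 : EuclideanSpace ℝ (Fin 3))} : Set (EuclideanSpace ℝ (Fin 3))).indicator
                    (fun _ => (1 : ℝ≥0∞)) p.2))) := by
  haveI := isSFiniteKernel_toMeasure (E := EuclideanSpace ℝ (Fin 3)) (δ := δ)
  have hΘmp := measurePreserving_reroot_campbell (δ := δ) hinv hw hws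
  have hfst := measurePreserving_fst_campbell (δ := δ) ν hw hw1
  -- name the involution and the weighted Campbell measure
  set Θ' : RootedHardCoreConfig (EuclideanSpace ℝ (Fin 3)) δ × EuclideanSpace ℝ (Fin 3) →
      RootedHardCoreConfig (EuclideanSpace ℝ (Fin 3)) δ × EuclideanSpace ℝ (Fin 3) :=
    fun p => ((if h : p.2 ∈ ((p.1.1 : LocalConfig (EuclideanSpace ℝ (Fin 3))) : Set (EuclideanSpace ℝ (Fin 3)))
      then p.1.reroot p.2 h else p.1 : RootedHardCoreConfig (EuclideanSpace ℝ (Fin 3)) δ), -p.2) with hΘ'_def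
  set π : Measure (RootedHardCoreConfig (EuclideanSpace ℝ (Fin 3)) δ × EuclideanSpace ℝ (Fin 3)) :=
    ((ν ⊗ₘ (⟨fun S : RootedHardCoreConfig (EuclideanSpace ℝ (Fin 3)) δ =>
        (S.1 : LocalConfig (EuclideanSpace ℝ (Fin 3))).toMeasure,
        measurable_toMeasure (Fact.out : 0 < δ)⟩ :
        Kernel (RootedHardCoreConfig (EuclideanSpace ℝ (Fin 3)) δ) (EuclideanSpace ℝ (Fin 3)))).withDensity
      (fun p : RootedHardCoreConfig (EuclideanSpace ℝ (Fin 3)) δ × EuclideanSpace ℝ (Fin 3) =>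
        w p.2 + (1 - ∫⁻ z, w z ∂((p.1.1 : LocalConfig (EuclideanSpace ℝ (Fin 3))).toMeasure)) *
          ({(0 : EuclideanSpace ℝ (Fin 3))} : Set (EuclideanSpace ℝ (Fin 3))).indicator
            (fun _ => (1 : ℝ≥0∞)) p.2)) with hπ_def
  -- the two isometries
  set E : Lp ℝ 2 ν →ₗᵢ[ℝ] Lp ℝ 2 π :=
    Lp.compMeasurePreservingₗᵢ ℝ (Prod.fst : RootedHardCoreConfig (EuclideanSpace ℝ (Fin 3)) δ ×
      EuclideanSpace ℝ (Fin 3) → RootedHardCoreConfig (EuclideanSpace ℝ (Fin 3)) δ) hfst with hE_def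
  set U : Lp ℝ 2 π →ₗᵢ[ℝ] Lp ℝ 2 π := Lp.compMeasurePreservingₗᵢ ℝ Θ' hΘmp with hU_def
  refine ⟨(ContinuousLinearMap.adjoint E.toContinuousLinearMap).comp
    (U.toContinuousLinearMap.comp E.toContinuousLinearMap), ?_, ?_⟩
  · -- `‖E† U E‖ ≤ 1`
    have hE1 : ‖E.toContinuousLinearMap‖ ≤ 1 := E.norm_toContinuousLinearMap_le
    have hU1 : ‖U.toContinuousLinearMap‖ ≤ 1 := U.norm_toContinuousLinearMap_le
    have hEa : ‖ContinuousLinearMap.adjoint E.toContinuousLinearMap‖ ≤ 1 := by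
      rw [LinearIsometryEquiv.norm_map]
      exact hE1
    calc ‖(ContinuousLinearMap.adjoint E.toContinuousLinearMap).comp
          (U.toContinuousLinearMap.comp E.toContinuousLinearMap)‖
        ≤ ‖ContinuousLinearMap.adjoint E.toContinuousLinearMap‖ *
            ‖U.toContinuousLinearMap.comp E.toContinuousLinearMap‖ := ContinuousLinearMap.opNorm_comp_le _ _
      _ ≤ 1 * (1 * 1) := by
          refine mul_le_mul hEa ((ContinuousLinearMap.opNorm_comp_le _ _).trans
            (mul_le_mul hU1 hE1 (norm_nonneg _) zero_le_one)) (norm_nonneg _) zero_le_one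
      _ = 1 := by norm_num
  · intro f g hf hg
    rw [ContinuousLinearMap.comp_apply, ContinuousLinearMap.comp_apply,
      ContinuousLinearMap.adjoint_inner_right]
    simp only [LinearIsometry.coe_toContinuousLinearMap]
    rw [MeasureTheory.L2.inner_def]
    -- the three a.e. identifications
    have h1 : ⇑(E (hg.toLp g)) =ᵐ[π] g ∘ Prod.fst :=
      (Lp.coeFn_compMeasurePreserving _ hfst).trans (hfst.quasiMeasurePreserving.ae_eq_comp hg.coeFn_toLp)
    have h2 : ⇑(E (hf.toLp f)) =ᵐ[π] f ∘ Prod.fst :=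
      (Lp.coeFn_compMeasurePreserving _ hfst).trans (hfst.quasiMeasurePreserving.ae_eq_comp hf.coeFn_toLp)
    have h3 : ⇑(U (E (hf.toLp f))) =ᵐ[π] (f ∘ Prod.fst) ∘ Θ' :=
      (Lp.coeFn_compMeasurePreserving _ hΘmp).trans (hΘmp.quasiMeasurePreserving.ae_eq_comp h2)
    refine integral_congr_ae ?_
    filter_upwards [h1, h3] with q hq1 hq3
    rw [hq1, hq3]
    simp only [Function.comp_apply, RCLike.inner_apply, conj_trivial]
    ring

end Summit.AtomisticToContinuum.Crystallization.Theorems.FrustratedLawDichotomyErgodicReduction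

end
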